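import Literature.Analysis.Complex.CrossTheoremThreeStrips
import Literature.Analysis.Complex.ConformalRadiusBoundary
import Literature.Analysis.Complex.OsgoodProofs
import Mathlib.Analysis.SpecialFunctions.Complex.LogDeriv
import Mathlib.Analysis.SpecialFunctions.Trigonometric.Basic
import Mathlib.Topology.Algebra.Module.FiniteDimension
import HarnessLib

/-!
# The local real cross theorem (separately real-analytic with uniform extensions ⇒ jointly analytic)

Analysis/Complex support file (everything proved; theorems only, no definitions, no named facts).

The classical theorem of S. N. Bernstein (1912) in the local form used for Euclidean correlation
functions: a function `P` of three real variables near `0` each of whose one-variable slices (the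
other two variables real and small) is the trace of a function holomorphic and bounded by `M` on the
disc of radius `ℓ` extends to ONE function holomorphic on a polydisc around `0 ∈ ℂ³` and bounded
by `M` (`exists_holomorphic_extension_of_separately_three_local`); the radius of the polydisc
depends on `ℓ` only (not on `P` or `M`). Proof: the map `ψ(ζ) = (e^ζ - 1)/(e^ζ + 1)` (`= tanh (ζ/2)`)
sends the strip `{|Im ζ| < π/2}` into the unit disc and `ℝ` onto `(-1, 1)`, so
`F(ζ₁, ζ₂, ζ₃) = P(ℓψ(ζ₁), ℓψ(ζ₂), ℓψ(ζ₃))` satisfies the hypotheses of the three-strip cross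
theorem `Literature.Analysis.Complex.exists_holomorphic_extension_of_separately_three`; its
extension is pulled back by the local inverse `A(z) = log((1 + z)/(1 - z))` of `ψ`, which is
holomorphic on the unit disc, real on `(-1, 1)`, and small near `0`. The two-variable diagonal
corollary `exists_holomorphic_extension_diagonal_of_separately_two_local` (the trace
`t ↦ H(t, -t)` extends to a disc) is what directional analyticity of reflection-positive
correlation functions consumes; the chart lemma `analyticAt_of_holomorphic_chart` turns a
holomorphic extension of `t ↦ f(x + Σ tₖ bₖ)` near `0 ∈ ℂ³` (`b` a basis of a real `3`-space) into
real analyticity of `f` at `x`.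

## References

* M. Jarnicki, P. Pflug, *Separately Analytic Functions*, EMS Tracts in Mathematics 16 (2011),
  Ch. 5 (classical cross theorem with estimate). [JarnickiPflug2011]
* S. N. Bernstein, Mém. Acad. Roy. Belgique (1912).
-/

noncomputable section

open _root_.Complex Set Filter Metric
open scoped _root_.Topology

namespace Literature.Analysis.Complex

/-! ### The Cayley–exponential map of the strip onto the disc and its local inverse

(`add_one_ne_zero_of_re_pos` and `norm_cayley_lt_one` — the Cayley map sends the right half-plane
into the unit disc — are imported from `ConformalRadiusBoundary.lean`.) -/

/-- On the strip `{|Im ζ| < π/2}` the exponential has positive real part. [folklore] -/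
theorem exp_re_pos_of_abs_im_lt {ζ : ℂ} (hζ : |ζ.im| < Real.pi / 2) : 0 < (exp ζ).re := by
  rw [Complex.exp_re]
  exact mul_pos (Real.exp_pos _) (Real.cos_pos_of_mem_Ioo ⟨by linarith [(abs_lt.1 hζ).1],
    (abs_lt.1 hζ).2⟩)

/-- **The map `ψ(ζ) = (e^ζ - 1)/(e^ζ + 1)` sends the strip `{|Im ζ| < π/2}` into the unit
disc.** [folklore] -/
theorem norm_cayleyExp_lt_one {ζ : ℂ} (hζ : |ζ.im| < Real.pi / 2) :
    ‖(exp ζ - 1) / (exp ζ + 1)‖ < 1 :=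
  norm_cayley_lt_one (exp_re_pos_of_abs_im_lt hζ)

/-- `ψ` is holomorphic on the strip `{|Im ζ| < π/2}`. [folklore] -/
theorem differentiableOn_cayleyExp :
    DifferentiableOn ℂ (fun ζ : ℂ => (exp ζ - 1) / (exp ζ + 1)) {ζ : ℂ | |ζ.im| < Real.pi / 2} :=
  fun _ hζ => ((Complex.differentiable_exp.differentiableAt.sub_const 1).div
    (Complex.differentiable_exp.differentiableAt.add_const 1)
    (add_one_ne_zero_of_re_pos (exp_re_pos_of_abs_im_lt hζ))).differentiableWithinAt

/-- `ψ` is real on the real axis: `ψ x = (e^x - 1)/(e^x + 1)` computed in `ℝ`. [folklore] -/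
theorem cayleyExp_ofReal (x : ℝ) :
    (exp (x : ℂ) - 1) / (exp (x : ℂ) + 1) = (((Real.exp x - 1) / (Real.exp x + 1) : ℝ) : ℂ) := by
  push_cast [Complex.ofReal_exp]
  ring

/-- The real map `ψ` takes values in `(-1, 1)`. [folklore] -/
theorem abs_cayleyExp_real_lt_one (x : ℝ) : |(Real.exp x - 1) / (Real.exp x + 1)| < 1 := by
  have he := Real.exp_pos x
  rw [abs_lt, lt_div_iff₀ (by linarith), div_lt_one (by linarith)]
  constructor <;> linarith

/-- For `‖z‖ < 1`, the Cayley preimage `(1 + z)/(1 - z)` has positive real part. [folklore] -/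
theorem cayleyInv_re_pos {z : ℂ} (hz : ‖z‖ < 1) : 0 < ((1 + z) / (1 - z)).re := by
  have hz1 : 1 - z ≠ 0 := by
    intro h
    have : z = 1 := by linear_combination -h
    rw [this, norm_one] at hz
    exact lt_irrefl _ hz
  have hns : 0 < normSq (1 - z) := Complex.normSq_pos.2 hz1
  have hlt : normSq z < 1 := by
    rw [← Complex.sq_norm]
    calc ‖z‖ ^ 2 < 1 ^ 2 := by gcongr
      _ = 1 := one_pow 2
  rw [Complex.div_re, ← add_div]
  refine div_pos ?_ hns
  rw [Complex.normSq_apply] at hlt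
  simp only [add_re, one_re, sub_re, add_im, one_im, sub_im, zero_add, zero_sub]
  nlinarith

/-- **The local inverse `A(z) = log((1 + z)/(1 - z))` of `ψ` is holomorphic on the unit disc.**
[folklore] -/
theorem differentiableAt_logCayleyInv {z : ℂ} (hz : ‖z‖ < 1) :
    DifferentiableAt ℂ (fun z : ℂ => log ((1 + z) / (1 - z))) z := by
  have hz1 : 1 - z ≠ 0 := by
    intro h
    have : z = 1 := by linear_combination -h
    rw [this, norm_one] at hz
    exact lt_irrefl _ hz
  refine DifferentiableAt.clog ?_ (Complex.mem_slitPlane_iff.2 (Or.inl (cayleyInv_re_pos hz)))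
  exact ((differentiableAt_const _).add differentiableAt_id).div
    ((differentiableAt_const _).sub differentiableAt_id) hz1

/-- `A` is real on `(-1, 1)`: `A x = log((1 + x)/(1 - x))` computed in `ℝ`. [folklore] -/
theorem logCayleyInv_ofReal {x : ℝ} (hx : |x| < 1) :
    log ((1 + (x : ℂ)) / (1 - (x : ℂ))) = ((Real.log ((1 + x) / (1 - x)) : ℝ) : ℂ) := by
  have h1 : 0 < 1 - x := by linarith [(abs_lt.1 hx).2]
  have h2 : 0 < 1 + x := by linarith [(abs_lt.1 hx).1]
  rw [Complex.ofReal_log (div_pos h2 h1).le]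
  push_cast
  ring_nf

/-- `ψ ∘ A = id` on `(-1, 1)` (real form). [folklore] -/
theorem cayleyExp_logCayleyInv_real {x : ℝ} (hx : |x| < 1) :
    (Real.exp (Real.log ((1 + x) / (1 - x))) - 1) / (Real.exp (Real.log ((1 + x) / (1 - x))) + 1)
      = x := by
  have h1 : 0 < 1 - x := by linarith [(abs_lt.1 hx).2]
  have h2 : 0 < 1 + x := by linarith [(abs_lt.1 hx).1]
  rw [Real.exp_log (div_pos h2 h1)]
  field_simp
  ring

/-- **The pull-back radius**: for every `ℓ > 0` there is `r > 0` such that `‖z‖ < r` implies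
`‖z/ℓ‖ < 1` and `|Im A(z/ℓ)| < π/6` (continuity of `A` at `0`, `A 0 = 0`). [folklore] -/
theorem exists_radius_logCayleyInv (ℓ : ℝ) (hℓ : 0 < ℓ) :
    ∃ r > 0, ∀ z : ℂ, ‖z‖ < r →
      ‖z / ℓ‖ < 1 ∧ |(log ((1 + z / ℓ) / (1 - z / ℓ))).im| < Real.pi / 6 := by
  have hA0 : ContinuousAt (fun z : ℂ => log ((1 + z) / (1 - z))) 0 :=
    (differentiableAt_logCayleyInv (by simp)).continuousAt
  have hT : {w : ℂ | |w.im| < Real.pi / 6} ∈ 𝓝 (log ((1 + (0 : ℂ)) / (1 - 0))) := by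
    refine (isOpen_lt (continuous_abs.comp Complex.continuous_im) continuous_const).mem_nhds ?_
    simp [Real.pi_pos]
  obtain ⟨r₁, hr₁, hball⟩ := Metric.mem_nhds_iff.1 (hA0.preimage_mem_nhds hT)
  refine ⟨ℓ * min r₁ 1, by positivity, fun z hz => ?_⟩
  have hzl : ‖z / ℓ‖ < min r₁ 1 := by
    rw [norm_div, Complex.norm_real, Real.norm_eq_abs, abs_of_pos hℓ, div_lt_iff₀ hℓ]
    linarith
  refine ⟨hzl.trans_le (min_le_right _ _), ?_⟩
  have : z / ℓ ∈ ball (0 : ℂ) r₁ := by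
    rw [mem_ball_zero_iff]; exact hzl.trans_le (min_le_left _ _)
  exact hball this

/-! ### The local cross theorem in three variables -/

/-- **The local real cross theorem in three variables** (Bernstein 1912; Jarnicki–Pflug 2011,
Ch. 5): for every `ℓ > 0` there is `r > 0` (depending on `ℓ` only) such that every function `P` of
three real variables whose slices in each variable, for the other two variables in `(-ℓ, ℓ)`, are
traces of functions holomorphic on the disc of radius `ℓ` and bounded by `M` there, is on
`(-r, r)³` the trace of ONE function holomorphic on the polydisc of radius `r` around `0 ∈ ℂ³` and
bounded by `M`. (Reparametrise by `ψ = tanh(·/2)`, apply the three-strip cross theorem, pull back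
by `A = 2 artanh`.) [cite: JarnickiPflug2011, Ch. 5 (classical cross theorem with estimate)] -/
theorem exists_holomorphic_extension_of_separately_three_local (ℓ : ℝ) (hℓ : 0 < ℓ) :
    ∃ r > 0, ∀ (M : ℝ) (P : ℝ → ℝ → ℝ → ℂ),
      (∀ y z : ℝ, |y| < ℓ → |z| < ℓ → ∃ g : ℂ → ℂ, DifferentiableOn ℂ g (ball (0 : ℂ) ℓ) ∧
        (∀ w ∈ ball (0 : ℂ) ℓ, ‖g w‖ ≤ M) ∧ ∀ x : ℝ, |x| < ℓ → g x = P x y z) →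
      (∀ x z : ℝ, |x| < ℓ → |z| < ℓ → ∃ g : ℂ → ℂ, DifferentiableOn ℂ g (ball (0 : ℂ) ℓ) ∧
        (∀ w ∈ ball (0 : ℂ) ℓ, ‖g w‖ ≤ M) ∧ ∀ y : ℝ, |y| < ℓ → g y = P x y z) →
      (∀ x y : ℝ, |x| < ℓ → |y| < ℓ → ∃ g : ℂ → ℂ, DifferentiableOn ℂ g (ball (0 : ℂ) ℓ) ∧
        (∀ w ∈ ball (0 : ℂ) ℓ, ‖g w‖ ≤ M) ∧ ∀ z : ℝ, |z| < ℓ → g z = P x y z) →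
      ∃ G : ℂ × ℂ × ℂ → ℂ,
        DifferentiableOn ℂ G {p : ℂ × ℂ × ℂ | ‖p.1‖ < r ∧ ‖p.2.1‖ < r ∧ ‖p.2.2‖ < r} ∧
        (∀ p : ℂ × ℂ × ℂ, ‖p.1‖ < r → ‖p.2.1‖ < r → ‖p.2.2‖ < r → ‖G p‖ ≤ M) ∧
        ∀ x y z : ℝ, |x| < r → |y| < r → |z| < r → G ((x : ℂ), (y : ℂ), (z : ℂ)) = P x y z := by
  obtain ⟨r, hr, hrad⟩ := exists_radius_logCayleyInv ℓ hℓ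
  refine ⟨r, hr, fun M P h1 h2 h3 => ?_⟩
  -- the reparametrised function of three real variables
  set ψr : ℝ → ℝ := fun u => ℓ * ((Real.exp u - 1) / (Real.exp u + 1)) with hψr
  have hψr_lt : ∀ u : ℝ, |ψr u| < ℓ := fun u => by
    rw [hψr, abs_mul, abs_of_pos hℓ]
    exact mul_lt_of_lt_one_right hℓ (abs_cayleyExp_real_lt_one u)
  -- the complex reparametrisation maps the strip into the disc of radius ℓ
  set ψc : ℂ → ℂ := fun ζ => (ℓ : ℂ) * ((exp ζ - 1) / (exp ζ + 1)) with hψc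
  have hψc_maps : MapsTo ψc {ζ : ℂ | |ζ.im| < Real.pi / 2} (ball (0 : ℂ) ℓ) := fun ζ hζ => by
    rw [mem_ball_zero_iff, hψc, norm_mul, Complex.norm_real, Real.norm_eq_abs, abs_of_pos hℓ]
    exact mul_lt_of_lt_one_right hℓ (norm_cayleyExp_lt_one hζ)
  have hψc_diff : DifferentiableOn ℂ ψc {ζ : ℂ | |ζ.im| < Real.pi / 2} :=
    differentiableOn_cayleyExp.const_mul _
  have hψc_real : ∀ u : ℝ, ψc u = ((ψr u : ℝ) : ℂ) := fun u => by
    rw [hψc, hψr]; dsimp only; rw [cayleyExp_ofReal]; push_cast; ring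
  -- transport a family of disc extensions to a family of strip extensions
  have key : ∀ {Q : ℝ → ℂ} {g : ℂ → ℂ}, DifferentiableOn ℂ g (ball (0 : ℂ) ℓ) →
      (∀ w ∈ ball (0 : ℂ) ℓ, ‖g w‖ ≤ M) → (∀ x : ℝ, |x| < ℓ → g x = Q x) →
      ∃ g' : ℂ → ℂ, DifferentiableOn ℂ g' {w : ℂ | |w.im| < Real.pi / 2} ∧
        (∀ w : ℂ, |w.im| < Real.pi / 2 → ‖g' w‖ ≤ M) ∧ ∀ u : ℝ, g' u = Q (ψr u) := by
    intro Q g hgd hgb hgr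
    refine ⟨fun ζ => g (ψc ζ), hgd.comp hψc_diff hψc_maps, fun w hw => hgb _ (hψc_maps hw),
      fun u => ?_⟩
    show g (ψc u) = Q (ψr u)
    rw [hψc_real, hgr _ (hψr_lt u)]
  have hb : (0 : ℝ) < Real.pi / 2 := by positivity
  obtain ⟨G, hGd, hGb, hGr⟩ := exists_holomorphic_extension_of_separately_three hb
    (F := fun u v w => P (ψr u) (ψr v) (ψr w)) (M := M)
    (fun v w => by
      obtain ⟨g, hgd, hgb, hgr⟩ := h1 (ψr v) (ψr w) (hψr_lt v) (hψr_lt w)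
      exact key hgd hgb hgr)
    (fun u w => by
      obtain ⟨g, hgd, hgb, hgr⟩ := h2 (ψr u) (ψr w) (hψr_lt u) (hψr_lt w)
      exact key (Q := fun y => P (ψr u) y (ψr w)) hgd hgb hgr)
    (fun u v => by
      obtain ⟨g, hgd, hgb, hgr⟩ := h3 (ψr u) (ψr v) (hψr_lt u) (hψr_lt v)
      exact key (Q := fun z => P (ψr u) (ψr v) z) hgd hgb hgr)
  -- pull back by the local inverse
  set A : ℂ → ℂ := fun z => log ((1 + z / ℓ) / (1 - z / ℓ)) with hA
  have hA_diff : ∀ z : ℂ, ‖z‖ < r → DifferentiableAt ℂ A z := fun z hz => by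
    have h := differentiableAt_logCayleyInv (hrad z hz).1
    have h2 : DifferentiableAt ℂ (fun z : ℂ => z / (ℓ : ℂ)) z := differentiableAt_id.div_const _
    exact h.comp z h2
  have hA_real : ∀ x : ℝ, |x| < r → A x = ((Real.log ((1 + x / ℓ) / (1 - x / ℓ)) : ℝ) : ℂ) := by
    intro x hx
    have h := (hrad x (by rwa [Complex.norm_real, Real.norm_eq_abs])).1
    rw [← Complex.ofReal_div, Complex.norm_real, Real.norm_eq_abs] at h
    rw [hA]; dsimp only
    rw [← Complex.ofReal_div, logCayleyInv_ofReal h]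
  have hψA : ∀ x : ℝ, |x| < r → ψr (Real.log ((1 + x / ℓ) / (1 - x / ℓ))) = x := by
    intro x hx
    have h := (hrad x (by rwa [Complex.norm_real, Real.norm_eq_abs])).1
    rw [← Complex.ofReal_div, Complex.norm_real, Real.norm_eq_abs] at h
    rw [hψr]; dsimp only
    rw [cayleyExp_logCayleyInv_real h]
    field_simp
  set Φ : ℂ × ℂ × ℂ → ℂ × ℂ × ℂ := fun p => (A p.1, A p.2.1, A p.2.2) with hΦ
  have hΦ_maps : ∀ p : ℂ × ℂ × ℂ, ‖p.1‖ < r → ‖p.2.1‖ < r → ‖p.2.2‖ < r →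
      |(Φ p).1.im| + |(Φ p).2.1.im| + |(Φ p).2.2.im| < Real.pi / 2 := by
    intro p h₁ h₂ h₃
    have e₁ := (hrad _ h₁).2
    have e₂ := (hrad _ h₂).2
    have e₃ := (hrad _ h₃).2
    simp only [hΦ]
    linarith
  refine ⟨fun p => G (Φ p), ?_, fun p h₁ h₂ h₃ => hGb _ (hΦ_maps p h₁ h₂ h₃), fun x y z hx hy hz => ?_⟩
  · refine hGd.comp (fun p hp => ?_) (fun p hp => hΦ_maps p hp.1 hp.2.1 hp.2.2)
    have d₁ : DifferentiableAt ℂ (fun p : ℂ × ℂ × ℂ => A p.1) p :=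
      (hA_diff _ hp.1).comp p differentiableAt_fst
    have d₂ : DifferentiableAt ℂ (fun p : ℂ × ℂ × ℂ => A p.2.1) p :=
      (hA_diff _ hp.2.1).comp p (differentiableAt_fst.comp p differentiableAt_snd)
    have d₃ : DifferentiableAt ℂ (fun p : ℂ × ℂ × ℂ => A p.2.2) p :=
      (hA_diff _ hp.2.2).comp p (differentiableAt_snd.comp p differentiableAt_snd)
    exact (d₁.prodMk (d₂.prodMk d₃)).differentiableWithinAt
  · show G (A x, A y, A z) = P x y z
    rw [hA_real x hx, hA_real y hy, hA_real z hz, hGr, hψA x hx, hψA y hy, hψA z hz]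

/-! ### The diagonal corollary in two variables -/

/-- **Local cross theorem, two variables, diagonal trace.** For every `ℓ > 0` there is `r > 0`
(depending on `ℓ` only) such that for every function `H` of two real variables whose slices in each
variable (the other in `(-ℓ, ℓ)`) are traces of functions holomorphic on the disc of radius `ℓ` and
bounded by `M`, the diagonal trace `t ↦ H(t, -t)` is on `(-r, r)` the trace of a function
holomorphic on the disc of radius `r` and bounded by `M`. (The three-variable theorem with a dummy
third variable, composed with `t ↦ (t, -t, 0)`.)
[cite: JarnickiPflug2011, Ch. 5 (classical cross theorem with estimate)] -/
theorem exists_holomorphic_extension_diagonal_of_separately_two_local (ℓ : ℝ) (hℓ : 0 < ℓ) :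
    ∃ r > 0, ∀ (M : ℝ) (H : ℝ → ℝ → ℂ),
      (∀ y : ℝ, |y| < ℓ → ∃ g : ℂ → ℂ, DifferentiableOn ℂ g (ball (0 : ℂ) ℓ) ∧
        (∀ w ∈ ball (0 : ℂ) ℓ, ‖g w‖ ≤ M) ∧ ∀ x : ℝ, |x| < ℓ → g x = H x y) →
      (∀ x : ℝ, |x| < ℓ → ∃ g : ℂ → ℂ, DifferentiableOn ℂ g (ball (0 : ℂ) ℓ) ∧
        (∀ w ∈ ball (0 : ℂ) ℓ, ‖g w‖ ≤ M) ∧ ∀ y : ℝ, |y| < ℓ → g y = H x y) →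
      ∃ g : ℂ → ℂ, DifferentiableOn ℂ g (ball (0 : ℂ) r) ∧
        (∀ w ∈ ball (0 : ℂ) r, ‖g w‖ ≤ M) ∧ ∀ t : ℝ, |t| < r → g t = H t (-t) := by
  obtain ⟨r, hr, hmain⟩ := exists_holomorphic_extension_of_separately_three_local ℓ hℓ
  refine ⟨r, hr, fun M H h1 h2 => ?_⟩
  -- the bound on the real points (from the first-variable extensions)
  have hHM : ∀ x y : ℝ, |x| < ℓ → |y| < ℓ → ‖H x y‖ ≤ M := by
    intro x y hx hy
    obtain ⟨g, -, hgb, hgr⟩ := h1 y hy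
    rw [← hgr x hx]
    exact hgb _ (by rwa [mem_ball_zero_iff, Complex.norm_real, Real.norm_eq_abs])
  obtain ⟨G, hGd, hGb, hGr⟩ := hmain M (fun x y _ => H x y)
    (fun y z hy _ => h1 y hy) (fun x z hx _ => h2 x hx)
    (fun x y hx hy => ⟨fun _ => H x y, differentiableOn_const _, fun w _ => hHM x y hx hy,
      fun z _ => rfl⟩)
  have hmaps : MapsTo (fun t : ℂ => (t, -t, (0 : ℂ))) (ball (0 : ℂ) r)
      {p : ℂ × ℂ × ℂ | ‖p.1‖ < r ∧ ‖p.2.1‖ < r ∧ ‖p.2.2‖ < r} := fun t ht => by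
    rw [mem_ball_zero_iff] at ht
    exact ⟨ht, by rwa [norm_neg], by simpa using hr⟩
  refine ⟨fun t => G (t, -t, 0), hGd.comp (fun t _ => ?_) hmaps, fun w hw => ?_, fun t ht => ?_⟩
  · exact (differentiableAt_id.prodMk (differentiableAt_id.neg.prodMk
      (differentiableAt_const _))).differentiableWithinAt
  · have h := hmaps hw
    exact hGb _ h.1 h.2.1 h.2.2
  · show G ((t : ℂ), -(t : ℂ), 0) = H t (-t)
    rw [← Complex.ofReal_neg, ← Complex.ofReal_zero, hGr t (-t) 0 ht (by rwa [abs_neg]) (by simpa using hr)]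

/-! ### From a holomorphic extension near `0 ∈ ℂ³` to real analyticity in a point -/

/-- **Chart lemma.** Let `b` be a basis of a real normed space `V` indexed by `Fin 3`, `f : V → ℝ`,
and suppose `(t₁, t₂, t₃) ↦ f (x + t₁ b₀ + t₂ b₁ + t₃ b₂)` agrees on `(-r, r)³` with a function `G`
holomorphic on the polydisc of radius `r` around `0 ∈ ℂ³`. Then `f` is real-analytic at `x`
(holomorphic ⇒ analytic by Osgood's lemma, restrict scalars, compose with the real-analytic affine
chart `w ↦ coordinates of w - x`, take real parts). [folklore] -/
theorem analyticAt_of_holomorphic_chart {V : Type*} [NormedAddCommGroup V] [NormedSpace ℝ V]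
    [CompleteSpace V] (b : Module.Basis (Fin 3) ℝ V) {f : V → ℝ} {x : V} {r : ℝ} (hr : 0 < r)
    {G : ℂ × ℂ × ℂ → ℂ}
    (hGd : DifferentiableOn ℂ G {p : ℂ × ℂ × ℂ | ‖p.1‖ < r ∧ ‖p.2.1‖ < r ∧ ‖p.2.2‖ < r})
    (hGr : ∀ t₁ t₂ t₃ : ℝ, |t₁| < r → |t₂| < r → |t₃| < r →
      G ((t₁ : ℂ), (t₂ : ℂ), (t₃ : ℂ)) = ((f (x + t₁ • b 0 + t₂ • b 1 + t₃ • b 2) : ℝ) : ℂ)) :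
    AnalyticAt ℝ f x := by
  haveI : FiniteDimensional ℝ V := b.finiteDimensional_of_finite
  -- the affine chart `w ↦ coordinates of w - x`, as a real-analytic map into `ℂ³`
  set φ : V → (Fin 3 → ℝ) := fun w => b.equivFun (w - x) with hφ
  have hφ_cont : Continuous φ := b.equivFunL.continuous.comp (continuous_id.sub continuous_const)
  have hφx : φ x = 0 := by simp [hφ]
  have hφ_an : AnalyticAt ℝ φ x :=
    (b.equivFunL.analyticAt _).comp ((analyticAt_id).sub analyticAt_const)
  set Ψ : V → ℂ × ℂ × ℂ := fun w =>
    (((φ w 0 : ℝ) : ℂ), ((φ w 1 : ℝ) : ℂ), ((φ w 2 : ℝ) : ℂ)) with hΨ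
  have hproj : ∀ i : Fin 3, AnalyticAt ℝ (fun w => ((φ w i : ℝ) : ℂ)) x := fun i =>
    (Complex.ofRealCLM.analyticAt _).comp
      (((ContinuousLinearMap.proj (R := ℝ) (φ := fun _ : Fin 3 => ℝ) i).analyticAt _).comp hφ_an)
  have hΨ_an : AnalyticAt ℝ Ψ x := (hproj 0).prod ((hproj 1).prod (hproj 2))
  have hΨx : Ψ x = ((0 : ℂ), (0 : ℂ), (0 : ℂ)) := by simp [hΨ, hφx]
  -- `G` is analytic at `Ψ x = 0`
  have hU : IsOpen {p : ℂ × ℂ × ℂ | ‖p.1‖ < r ∧ ‖p.2.1‖ < r ∧ ‖p.2.2‖ < r} := by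
    refine (isOpen_lt continuous_fst.norm continuous_const).and
      ((isOpen_lt ?_ continuous_const).and (isOpen_lt ?_ continuous_const)) <;> fun_prop
  have hG_an : AnalyticAt ℂ G (Ψ x) := by
    rw [hΨx]
    exact SCV.analyticAt_of_differentiableOn hGd hU (by simp [hr])
  have hcomp : AnalyticAt ℝ (fun w => (G (Ψ w)).re) x :=
    (Complex.reCLM.analyticAt _).comp ((hG_an.restrictScalars (𝕜 := ℝ)).comp hΨ_an)
  -- `f` agrees with the composite near `x`
  refine hcomp.congr ?_
  have hev : ∀ᶠ w in 𝓝 x, ∀ i : Fin 3, |φ w i| < r := by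
    refine Filter.eventually_all.2 fun i => ?_
    have hc : Continuous fun w => |φ w i| := (continuous_abs.comp ((continuous_apply i).comp hφ_cont))
    refine (hc.continuousAt.eventually_lt continuousAt_const ?_)
    simp [hφx, hr]
  filter_upwards [hev] with w hw
  have hsum : x + φ w 0 • b 0 + φ w 1 • b 1 + φ w 2 • b 2 = w := by
    have h := b.sum_equivFun (w - x)
    rw [Fin.sum_univ_three] at h
    have h' : φ w 0 • b 0 + φ w 1 • b 1 + φ w 2 • b 2 = w - x := h
    rw [show x + φ w 0 • b 0 + φ w 1 • b 1 + φ w 2 • b 2 =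
      x + (φ w 0 • b 0 + φ w 1 • b 1 + φ w 2 • b 2) by abel, h']
    abel
  show (G (Ψ w)).re = f w
  rw [hΨ]; dsimp only
  rw [hGr _ _ _ (hw 0) (hw 1) (hw 2), hsum, Complex.ofReal_re]

end Literature.Analysis.Complex


end
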